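import Literature.MathematicalPhysics.QuantumFieldTheory.Balaban1983to89.B9Eq325RofUkSupRowClosed
import HarnessLib

/-!
# Route `UnitScaleTilt`, crux K1 «MinimiserStabilityRegPr» (stmt-QuantumFields-19200), stub `stub_existenceMinimalOrbit` (EX) — N06 print row `h349` of the EX display
# (S31ᴸ ✓p703595 :245–:250), FLAT-CERTIFICATE ROAD, FILE 1∕4 «(3.49) KERNEL ASSEMBLY AT THE TOWER»: **THE POINTWISE KERNEL ROW OF PRINT's `D_U(1 − R_k(U))D_U*` ON A
# ONE-BOND SOURCE, ON PRINT's DIAGONAL WINDOW, `∃ (α₁, C, δ)` BEFORE THE HEIGHT** — [Balaban1985BackgroundPropagators] (3.49) p. 399 «`|(DPD*)(x,x′)| ≤ O(1)·e^{−δ₀d(y,y′)}`,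
# `x ∈ Δ(y)`, `x′ ∈ Δ(y′)`» in the `η^d`-kernel convention (3.11): the value of `D_U P_k D_U*` (`P_k := 1 − R_k`, `R_k` = (3.21) at `k = n+1` levels) on the field
# carrying `z` on the single fine bond `b` is, at every fine bond `b′`, `≤ C·(L^{n+1})^{−d}·e^{−δ·d_m(Π(b′₊), Π(b₊))}·‖z‖`, uniformly in the height, the volume and the background

Cell `ym3-torus`, width seat `ym3-torus-px20` (gen 6); ★★OWNER g30 WORD 5 (LOCATE «does the tree supply the η-uniform pointwise decay of the flat massive propagator?» —
answered YES by the pub-balaban NE9 TOWER sup-letter chain, memo `LOCATE-H349-FLATCERT-TOWER-px20g6.md` = 19200 evidence #60).  THEOREMS ONLY (0 `def`, 0 `sorry`);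
`--supports stmt-QuantumFields-19200 --as helper`, count-neutral.  YM₃ on T³ is a ladder rung (R3), not d = 4, not infinite volume, not the Clay problem; nothing here
claims the displayed row `h349` (curved `U₀ ∈ RegPr`), N06, the stub, the crux or the mass gap.

THE MECHANISM (memo §3).  (3.25) at the tower (✓`B9Eq325ProjFormulaTower.RofUk_eq_formula`): `1 − R_k = G′_kQ̃′_k† · c_k · Q̃′_kG′_k`, `G′_k = GpOfUk`, `c_k = greenK … (QGGQk_pos …)`;
so `D_UP_kD_U*χ = (D_UG′_kQ̃′_k†)·c_k·(Q̃′_kG′_kD_U*χ)`.  The RIGHT factor on the one-bond source `χ = χ_b z` is read by DUALITY on the unit coarse lattice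
(`c₁·‖(Q̃′G′D*χ)(v′)‖² = ⟨D_UG′_kQ̃′_k†(δ_{v′}⊗u), χ⟩ = c₀·⟨(D_UG′_kQ̃′_k†(δ_{v′}⊗u))(b), z⟩`; `G′_k† = G′_k` ✓`adjoint_GpOfUk`, `D_U*` := the Hilbert adjoint), so (GRC)
✓`B9Eq342GreenPrimeTowerGradientRowClosed.exists_gradRow_GpOfUk` ∘ the `Q̃′_k†` range-`0`∕size-`1` letters gives `‖(Q̃′G′D*χ)(v′)‖ ≤ (c₀∕c₁)·B_D·e^{−κ·d_m(v′,Π(b₊))}·‖z‖`, and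
`c₀∕c₁ = (L^{n+1})^{−d}` on the diagonal — PRINT's `η^d`.  Middle factor (K64a) ✓`B9Eq326WoodburyLettersTower.exists_local_letter_QGGQInvk_closed`, left factor (GRC)∘`Q̃′_k†`
again; three (K61) ✓`letter_comp` with ✓`torusSum_le`.  Idiom, binder block and CLM bookkeeping = (K70) ✓`B9Eq3152GreenPrimeProjGradRowClosed` ∕ (K76a) ✓`B9Eq325RofUkSupRowClosed`.

WHAT IS PROVED (ns `Summit.QuantumFields.YangMills.Theorems.Prop7TowerDPDstarPointRow`; sorry-free; [folklore] composition of landed lit letters, nothing restated).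
* ★★★`exists_pointRow_DPDstar_tower` — `∃ α₁ C δ`, `0 < α₁`, `0 ≤ C`, `0 < δ`, BEFORE (K70)'s binder block verbatim (`n η c₀ c₁ m U αU … hpos′`), such that for all fine bonds
  `b b′` and `z : W`: `‖(D_U((1 − R_k)(D_U†((χ_b z)))))(b′)‖ ≤ C·((L^{n+1})^d)⁻¹·e^{−δ·d_m(Π(b′₊), Π(b₊))}·‖z‖`, `χ_b z := (WL2.linearEquiv …)⁻¹ (Pi.single b z)`,
  `C = ((B_D·B_C·K)·(1·e^{κ·0})·K)·B_D·K`, `K = K_d(κ∕2)`, `κ = min(κ_D, ρ_C)`, `δ = κ∕2`.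
CONSUMERS (memo §4): F2 flat tower datum (`U := 1`), F3 member dictionary (`RS 1 = RofUk 1`, chart ✓`siteEquivTowerAt`), F4 `h349_at_one`; the curved road of memo §5 too.
HONEST SCOPE.  Composition of landed letters; constants crude; nothing of [B9] Thm 3.1∕3.11∕(3.49) at general backgrounds beyond the cell's MODEL letters is asserted; the window
binders stay hypotheses here (FILE 2 discharges them at `U = 1`).  Rung R3 (YM₃ on T³), not Clay; YM gap NOT proved.

References: T. Bałaban, CMP **99** (1985) 389–434 [Balaban1985BackgroundPropagators] ((3.49) p.399, (3.25) p.394, (3.21) p.394, (3.11) p.392, (3.8) p.392, Thm 3.1 (3.42) p.397,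
Thm 3.11 p.416); CMP **102** (1985) 277–309 [Balaban1985Variational] (p.299 l.13 «`DPD*` is a bounded operator»).
-/

noncomputable section

set_option autoImplicit false
open scoped InnerProductSpace ComplexConjugate BigOperators

namespace Summit.QuantumFields.YangMills.Theorems.Prop7TowerDPDstarPointRow

open Literature.MathematicalPhysics.QuantumFieldTheory.Balaban1983to89
open B4Sect5Torus (TSite tdist tdist_nonneg tdist_symm tdist_self tdist_triangle torusSum_le)
open B4Sect5Proof (latticeConst latticeConst_nonneg)
open B9SectCLatticeCarrier (Bond DirPair bpos btgt shift unshift)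
open B9Eq311L2Pairing (WL2)
open B9Eq319QprimeTorus (fineP blockCoord)
open B7Prop1Explicit (U1 Wcx boxVec)
open B11Eq103H1Complex (SiteL2K BondL2K greenK covDerivL2K)
open B9Eq310DeltaPrime (plaqHolU)
open B9Eq310HessianOperator (adTransportW)
open B9Eq310HessianHermitian (adTransportW_adjoint)
open B9Eq315QTorus (perCfg cornerSite)
open B9Eq315QTower (towerP UlevOf)
open B9Eq316TowerFlatIsOneStep (towerP_eq_fineP_pow siteCast)
open B9Eq326OperatorTower (QprimeTowerW RofUk)
open B9Eq324DeltaPrimeATower (laplacePrimeAk GpOfUk)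
open B9Eq325ProjFormulaTower (QGGQk_pos RofUk_eq_formula)
open B9Eq349BlockMultipliers (exists_block_clm_family)
open B9Eq326WoodburyLettersTower (exists_local_letter_QGGQInvk_closed adjoint_GpOfUk)
open B9Eq342GreenPrimeTowerGradientRowClosed (exists_gradRow_GpOfUk)
open B9Eq324PenaltyPointwiseBound (norm_adjoint_QtildeTower_apply_le)
open B9Eq324PenaltyBlockLocal (adjoint_QtildeTower_apply_eq_of_eq_at)
open B9Eq342GreenPrimeTowerSupBoundDecay (bigBlock_eq_iff)
open B9Eq347LocalFromBlockDecay (norm_le_sqrt_mass_mul)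
open B9Eq326G1SupRowOfLetters (letter_comp)
open B9Eq3126H1SupRowOfLetters (letter_of_range)

variable {d : ℕ} (hd : 1 ≤ d) (L : ℕ) [NeZero L] (hL : 1 ≤ L) (hL3 : 3 ≤ L)
  {𝔸 : Type*} [NormedRing 𝔸] [NormedAlgebra ℂ 𝔸] [CompleteSpace 𝔸] [NormOneClass 𝔸] [StarRing 𝔸] [NormedStarGroup 𝔸] [StarModule ℂ 𝔸]
  {W : Type*} [NormedAddCommGroup W] [InnerProductSpace ℂ W] [FiniteDimensional ℂ W] (φ : W ≃ₗ[ℂ] 𝔸)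
  {Mφ Mφ' : ℝ} (hMφ : 0 ≤ Mφ) (hMφ' : 0 ≤ Mφ') (hφ : ∀ w, ‖φ w‖ ≤ Mφ * ‖w‖) (hφ' : ∀ X, ‖φ.symm X‖ ≤ Mφ' * ‖X‖) (hstar : ∀ X : 𝔸, ‖star X‖ ≤ ‖X‖)
  {a : ℝ} (ha : 0 < a) {a' : ℝ} (ha' : 0 < a') {ϱ : ℝ} (hϱ0 : 0 ≤ ϱ) (hϱ1 : ϱ < 1)
  (τ : 𝔸 →ₗ[ℂ] ℂ) {Cτ : ℝ} (hτ : ∀ X, ‖τ X‖ ≤ Cτ * ‖X‖) (hCτ : 0 ≤ Cτ) {Mτ : ℝ} (hτm : ∀ X Y : 𝔸, ‖τ (X * Y)‖ ≤ Mτ * ‖X‖ * ‖Y‖) (hMτ : 0 ≤ Mτ)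
  {ρw : ℝ} (hρw : 0 ≤ ρw)
  (hτ₁ : ∀ X : 𝔸, τ (star X) = conj (τ X)) (hτ₂ : ∀ X Y : 𝔸, τ (X * Y) = τ (Y * X)) (hφτ : ∀ X Y : 𝔸, ⟪φ.symm X, φ.symm Y⟫_ℂ = τ (star X * Y))
  (AQ : ℝ)

omit [NeZero L] in
/-- `e^{−r t} ≤ e^{−κ t}` for `κ ≤ r`, `0 ≤ t`. [folklore] -/
private theorem exp_weaken' {r κ t : ℝ} (hκ : κ ≤ r) (ht : 0 ≤ t) : Real.exp (-(r * t)) ≤ Real.exp (-(κ * t)) :=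
  Real.exp_le_exp.2 (by nlinarith)

omit [FiniteDimensional ℂ W] in
/-- The weighted `ℓ²` pairing of a one-point field: `⟪δ_y⊗u, g⟫_{w} = w(y)·⟪u, g(y)⟫`. [folklore] [cite: Balaban1985BackgroundPropagators, (3.11) p.392] -/
private theorem inner_single_left {X : Type*} [Fintype X] [DecidableEq X] {w : X → ℝ} [Fact (∀ x, 0 < w x)] (y : X) (u : W) (g : WL2 ℂ w W) :
    ⟪(WL2.linearEquiv ℂ ℂ w).symm (Pi.single y u), g⟫_ℂ = (w y : ℂ) * ⟪u, WL2.equiv ℂ w W g y⟫_ℂ := by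
  rw [WL2.inner_def]
  rw [Finset.sum_eq_single y]
  · simp
  · intro x _ hx
    simp [Pi.single_eq_of_ne hx]
  · intro h; exact absurd (Finset.mem_univ y) h

set_option maxHeartbeats 400000 in
-- HEARTBEAT rule (README ∕ RULING №24 (a)): one 30-binder statement + three `letter_comp` words + the duality `rw` chain; passes at the default 200k (≈ 20 s farm) but not at
-- 100k, so the decl carries an explicit decl-local 400k margin (no file-global line).
include hd hL hL3 hMφ hMφ' hφ hφ' ha ha' hϱ0 hϱ1 hτ hCτ hMτ hρw hτ₁ hτ₂ hφτ in
/-- ★★★ **THE POINTWISE KERNEL ROW OF `D_U P_k D_U*` ON A ONE-BOND SOURCE, ON PRINT's DIAGONAL, `∃ (α₁, C, δ)` BEFORE THE HEIGHT** ([Balaban1985BackgroundPropagators]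
(3.49) p. 399, `η^d`-kernel convention (3.11); `P_k = 1 − R_k`, `R_k` the projection (3.21) onto `Δ^η_UN(Q′_k(U))` at `k = n+1` levels): for every datum of (K70)'s binder block,
all fine bonds `b b′` and `z : W`, `‖(D_U((1 − R_k)(D_U†(χ_b z))))(b′)‖ ≤ C·((L^{n+1})^d)⁻¹·e^{−δ·d_m(Π(b′₊), Π(b₊))}·‖z‖`.  Proof: (3.25) `RofUk_eq_formula`; the coarse field
`Q̃′_k(G′_k(D_U†χ))` bounded pointwise BY DUALITY (`adjoint_GpOfUk`, (GRC) `exists_gradRow_GpOfUk` ∘ the `Q̃′_k†` letters — this is where `c₀∕c₁ = (L^{n+1})^{−d}` enters); then (K64a)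
`exists_local_letter_QGGQInvk_closed`, then (GRC) ∘ `Q̃′_k†` again — three `letter_comp`.
[cite: Balaban1985BackgroundPropagators, (3.49) p.399, (3.25) p.394, (3.21) p.394, Thm 3.1 (3.42) p.397, Thm 3.11 p.416, (3.11) p.392] -/
theorem exists_pointRow_DPDstar_tower :
    ∃ α₁ C δ : ℝ, 0 < α₁ ∧ 0 ≤ C ∧ 0 < δ ∧
      ∀ (n : ℕ) (η : ℝ) (_hηL : η * (L : ℝ) ^ (n + 1) = 1) (c₀ c₁ : ℝ) [Fact (0 < c₀)] [Fact (0 < c₁)]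
        (_hw : c₀ * ((L : ℝ) ^ (n + 1)) ^ d = c₁) (_hρ : |η| ^ d / c₀ ≤ ρw) (m : Fin d → ℕ) [∀ i, NeZero (m i)] (_hm : ∀ i, 1 ≤ m i)
        (U : Bond d (towerP L m (n + 1)) → 𝔸ˣ) (αU : ℕ → ℝ) (_hα0 : ∀ j, 0 ≤ αU j) (hα1 : ∀ j, αU j ≤ 1 / 64)
        (hU1 : ∀ (j : ℕ) (x : B7Prop1Explicit.Site d) (k : Fin d), perCfg (towerP L m (j + 1)) (UlevOf L m (n + 1) U j) x k ∈ U1 𝔸)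
        (hreg : ∀ (j : ℕ) (y : TSite d (towerP L m j)) (k : Fin d) (ρ' : Fin d → Fin L),
          ‖((Wcx L (perCfg (towerP L m (j + 1)) (UlevOf L m (n + 1) U j)) (cornerSite L y) k (boxVec L ρ') : 𝔸ˣ) : 𝔸) - 1‖ ≤ αU j)
        (εU : ℕ → ℝ) (_hεU : ∀ j, 0 ≤ εU j) (_hUε : ∀ (j : ℕ) (b : Bond d (towerP L m (j + 1))), ‖(UlevOf L m (n + 1) U j b : 𝔸) - 1‖ ≤ εU j)
        (_hLb : ∀ (j : ℕ) (b : Bond d (towerP L m (j + 1))), UlevOf L m (n + 1) U j b ∈ U1 𝔸)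
        (α : ℝ) (_hα : 0 ≤ α) (_hαle : α ≤ α₁)
        (hUst : ∀ b, star (U b : 𝔸) = (((U b)⁻¹ : 𝔸ˣ) : 𝔸)) (_hUb : ∀ b, U b ∈ U1 𝔸) (_hUη : ∀ b, ‖(U b : 𝔸) - 1‖ ≤ α * η)
        (_hpl : ∀ p : B9SectCLatticeCarrier.Plaq d (towerP L m (n + 1)), ‖(plaqHolU U p : 𝔸) - 1‖ ≤ α * η ^ 2)
        (_hUgrad : ∀ (x : TSite d (towerP L m (n + 1))) (μ : Fin d), ‖(U (x, μ) : 𝔸) - U (unshift μ x, μ)‖ ≤ α * η ^ 2)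
        (_hRlev : ∀ (j : ℕ) (b : Bond d (towerP L m (j + 1))) (w : W), ‖adTransportW φ (UlevOf L m (n + 1) U j) b w‖ ≤ ‖w‖)
        (_hεg : ∀ j < n + 1, εU j ≤ α * ϱ ^ j) (_hAQ : ∑ j ∈ Finset.range (n + 1), αU j ≤ AQ)
        (hpos' : ∀ x : SiteL2K ℂ d (towerP L m (n + 1)) c₀ W, x ≠ 0 → 0 < RCLike.re ⟪x, laplacePrimeAk L m n φ η U a' (c₁ := c₁) x⟫_ℂ)
        (b b' : Bond d (towerP L m (n + 1))) (z : W),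
        ‖WL2.equiv ℂ (fun _ : Bond d (towerP L m (n + 1)) => c₀) W (covDerivL2K ℂ c₀ ((η : ℂ))⁻¹ (adTransportW φ U)
            (LinearMap.adjoint (covDerivL2K ℂ c₀ ((η : ℂ))⁻¹ (adTransportW φ U))
                ((WL2.linearEquiv ℂ ℂ (fun _ : Bond d (towerP L m (n + 1)) => c₀)).symm (Pi.single b z)) -
              RofUk L m n φ η U (c₀ := c₀)
                (LinearMap.adjoint (covDerivL2K ℂ c₀ ((η : ℂ))⁻¹ (adTransportW φ U))
                  ((WL2.linearEquiv ℂ ℂ (fun _ : Bond d (towerP L m (n + 1)) => c₀)).symm (Pi.single b z))))) b'‖ ≤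
          C * (((L : ℝ) ^ (n + 1)) ^ d)⁻¹ *
            Real.exp (-(δ * tdist m (blockCoord (L ^ (n + 1)) m (siteCast (towerP_eq_fineP_pow L m (n + 1)) (btgt b')))
              (blockCoord (L ^ (n + 1)) m (siteCast (towerP_eq_fineP_pow L m (n + 1)) (btgt b))))) * ‖z‖ := by
  classical
  have hL2 : 2 ≤ L := le_trans (by norm_num) hL3
  obtain ⟨αD, BD, κD, hαD, hBD, hκD, HD⟩ := exists_gradRow_GpOfUk L φ hMφ hMφ' hφ hφ' ha' hϱ0 hϱ1 τ hτ₂ hφτ hd hL2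
  obtain ⟨αC, BC, ρC, hαC, hBC, hρC, HC⟩ := exists_local_letter_QGGQInvk_closed hd L hL hL3 φ hMφ hMφ' hφ hφ' ha ha' hϱ0 hϱ1 τ hτ hCτ hρw hτ₁ hτ₂ hφτ hMτ
  obtain ⟨κ, hκdef⟩ : ∃ κ : ℝ, κ = min κD ρC := ⟨_, rfl⟩
  have hκ0 : 0 < κ := by rw [hκdef]; exact lt_min hκD hρC
  have hκD' : κ ≤ κD := by rw [hκdef]; exact min_le_left _ _
  have hκC' : κ ≤ ρC := by rw [hκdef]; exact min_le_right _ _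
  obtain ⟨αs, hαs⟩ : ∃ αs : ℝ, αs = min αD αC := ⟨_, rfl⟩
  have hαs0 : 0 < αs := by rw [hαs]; exact lt_min hαD hαC
  obtain ⟨K, hKdef⟩ : ∃ K : ℝ, K = latticeConst d (κ - κ / 2) := ⟨_, rfl⟩
  have hK0 : 0 ≤ K := by rw [hKdef]; exact latticeConst_nonneg d (sub_pos.2 (half_lt_self hκ0)).le
  obtain ⟨Bs, hBs⟩ : ∃ Bs : ℝ, Bs = BD * BC * K * (1 * Real.exp (κ * 0)) * K * BD * K := ⟨_, rfl⟩
  have hBs0 : 0 ≤ Bs := by rw [hBs]; positivity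
  refine ⟨αs, Bs, κ / 2, hαs0, hBs0, by positivity, ?_⟩
  intro n η hηL c₀ c₁ _ _ hw hρ m _ hm U αU hα0 hα1 hU1 hreg εU hεU hUε hLb α hα hαle hUst hUb hUη hpl hUgrad hRlev hεg hAQ hpos' b b' z
  have hc₀ : (0 : ℝ) < c₀ := Fact.out
  have hc₁ : (0 : ℝ) < c₁ := Fact.out
  haveI : Nonempty (TSite d (towerP L m (n + 1))) := ⟨b.1⟩
  -- the source block
  obtain ⟨vb, hvb⟩ : ∃ v : TSite d m, v = blockCoord (L ^ (n + 1)) m (siteCast (towerP_eq_fineP_pow L m (n + 1)) (btgt b)) := ⟨_, rfl⟩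
  haveI : Nonempty (TSite d m) := ⟨vb⟩
  have hRS : ∀ (b : Bond d (towerP L m (n + 1))) (v u : W), ⟪adTransportW φ U b v, u⟫_ℂ = ⟪v, adTransportW φ (fun b => (U b)⁻¹) b u⟫_ℂ :=
    adTransportW_adjoint φ τ hτ₂ hUst hφτ
  have hαD_ : α ≤ αD := hαle.trans (by rw [hαs]; exact min_le_left _ _)
  have hαC_ : α ≤ αC := hαle.trans (by rw [hαs]; exact min_le_right _ _)
  have hLp : (0 : ℝ) < ((L : ℝ) ^ (n + 1)) ^ d := by positivity
  have hratio : c₀ / c₁ = (((L : ℝ) ^ (n + 1)) ^ d)⁻¹ := by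
    rw [← hw]; field_simp
  obtain ⟨PS, hPS⟩ := exists_block_clm_family (𝕜 := ℂ) (w := fun _ : TSite d (towerP L m (n + 1)) => c₀) (V := W)
    (fun x : TSite d (towerP L m (n + 1)) => blockCoord (L ^ (n + 1)) m (siteCast (towerP_eq_fineP_pow L m (n + 1)) x))
  obtain ⟨rY, hrY⟩ := exists_block_clm_family (𝕜 := ℂ) (w := fun _ : TSite d m => c₁) (V := W) (id : TSite d m → TSite d m)
  -- the letters `Q̃′_k`, `Q̃′_k†`, `c`, `G′_k`, `D_UG′_k`, `D_U`, `D_U†`, the one-bond embedding, as linear maps ∕ CLMs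
  obtain ⟨Qt, hQt⟩ : ∃ Qt : SiteL2K ℂ d (towerP L m (n + 1)) c₀ W →ₗ[ℂ] SiteL2K ℂ d m c₁ W,
      Qt = (WL2.linearEquiv ℂ ℂ (fun _ : TSite d m => c₁)).symm.toLinearMap ∘ₗ QprimeTowerW L m n φ U (c₀ := c₀) := ⟨_, rfl⟩
  obtain ⟨c, hc⟩ : ∃ c : SiteL2K ℂ d m c₁ W →ₗ[ℂ] SiteL2K ℂ d m c₁ W, c = greenK _ (QGGQk_pos L m n φ c₀ η U c₁ a' hRS hpos') := ⟨_, rfl⟩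
  obtain ⟨GP, hGP⟩ : ∃ T : SiteL2K ℂ d (towerP L m (n + 1)) c₀ W →ₗ[ℂ] SiteL2K ℂ d (towerP L m (n + 1)) c₀ W,
      T = GpOfUk L m n φ η U a' (c₁ := c₁) hpos' := ⟨_, rfl⟩
  obtain ⟨Dl, hDl⟩ : ∃ T : SiteL2K ℂ d (towerP L m (n + 1)) c₀ W →ₗ[ℂ] BondL2K ℂ d (towerP L m (n + 1)) c₀ W,
      T = covDerivL2K ℂ c₀ ((η : ℂ))⁻¹ (adTransportW φ U) := ⟨_, rfl⟩
  obtain ⟨Eb, hEb⟩ : ∃ T : W →ₗ[ℂ] BondL2K ℂ d (towerP L m (n + 1)) c₀ W,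
      T = (WL2.linearEquiv ℂ ℂ (fun _ : Bond d (towerP L m (n + 1)) => c₀)).symm.toLinearMap ∘ₗ LinearMap.single ℂ (fun _ : Bond d (towerP L m (n + 1)) => W) b :=
    ⟨_, rfl⟩
  obtain ⟨Ev, hEv⟩ : ∃ T : SiteL2K ℂ d m c₁ W →ₗ[ℂ] W,
      T = LinearMap.proj vb ∘ₗ (WL2.linearEquiv ℂ ℂ (fun _ : TSite d m => c₁)).toLinearMap := ⟨_, rfl⟩
  obtain ⟨Qcl, hQcl⟩ : ∃ T : SiteL2K ℂ d (towerP L m (n + 1)) c₀ W →L[ℂ] SiteL2K ℂ d m c₁ W, T = LinearMap.toContinuousLinearMap Qt := ⟨_, rfl⟩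
  obtain ⟨Qacl, hQacl⟩ : ∃ T : SiteL2K ℂ d m c₁ W →L[ℂ] SiteL2K ℂ d (towerP L m (n + 1)) c₀ W,
      T = LinearMap.toContinuousLinearMap (LinearMap.adjoint Qt) := ⟨_, rfl⟩
  obtain ⟨DGcl, hDGcl⟩ : ∃ T : SiteL2K ℂ d (towerP L m (n + 1)) c₀ W →L[ℂ] BondL2K ℂ d (towerP L m (n + 1)) c₀ W,
      T = LinearMap.toContinuousLinearMap (Dl ∘ₗ GP) := ⟨_, rfl⟩
  obtain ⟨Ccl, hCcl⟩ : ∃ T : SiteL2K ℂ d m c₁ W →L[ℂ] SiteL2K ℂ d m c₁ W, T = LinearMap.toContinuousLinearMap c := ⟨_, rfl⟩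
  -- the FIRST operator of the chain: coarse field `h ↦ Q̃′_k(G′_k(D_U†(χ_b (h vb))))`
  obtain ⟨T1, hT1⟩ : ∃ T : SiteL2K ℂ d m c₁ W →L[ℂ] SiteL2K ℂ d m c₁ W,
      T = LinearMap.toContinuousLinearMap (Qt ∘ₗ GP ∘ₗ LinearMap.adjoint Dl ∘ₗ Eb ∘ₗ Ev) := ⟨_, rfl⟩
  -- the ADJOINT averaging `Q̃′_k†`: value at `x` reads `g(Πx)` only; size `‖g‖_∞` on the diagonal ((K64) §2's two steps, (K70) verbatim)
  have hQaM : ∀ (g : SiteL2K ℂ d m c₁ W) (Gs : ℝ), (∀ u, ‖WL2.equiv ℂ (fun _ : TSite d m => c₁) W g u‖ ≤ Gs) →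
      ∀ x, ‖WL2.equiv ℂ (fun _ : TSite d (towerP L m (n + 1)) => c₀) W (Qacl g) x‖ ≤ 1 * Gs := by
    intro g Gs hgG x
    have hG0 : 0 ≤ Gs := (norm_nonneg _).trans (hgG vb)
    obtain ⟨z₀, hz₀⟩ : ∃ z₀ : TSite d m, z₀ = blockCoord (L ^ (n + 1)) m (siteCast (towerP_eq_fineP_pow L m (n + 1)) x) := ⟨_, rfl⟩
    have hloc : WL2.equiv ℂ (fun _ : TSite d (towerP L m (n + 1)) => c₀) W (Qacl g) x =
        WL2.equiv ℂ (fun _ : TSite d (towerP L m (n + 1)) => c₀) W (Qacl (rY z₀ g)) x := by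
      rw [hQacl, LinearMap.coe_toContinuousLinearMap', hQt]
      exact adjoint_QtildeTower_apply_eq_of_eq_at L m n φ (c₀ := c₀) U g (rY z₀ g) x (fun z hz => by
        have hz' : blockCoord (L ^ (n + 1)) m (siteCast (towerP_eq_fineP_pow L m (n + 1)) x) = z := (bigBlock_eq_iff L m n x z).2 hz
        rw [hrY, if_pos (show id z = z₀ from hz'.symm.trans hz₀.symm)])
    rw [hloc]
    have hμ : ∑ y : TSite d m, (if id y = z₀ then c₁ else 0) ≤ c₁ := by
      show ∑ y : TSite d m, (if y = z₀ then c₁ else 0) ≤ c₁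
      rw [Finset.sum_ite_eq' Finset.univ z₀ (fun _ => c₁), if_pos (Finset.mem_univ _)]
    have hgn : ‖rY z₀ g‖ ≤ Real.sqrt c₁ * Gs :=
      norm_le_sqrt_mass_mul (π := id) (w := fun _ : TSite d m => c₁) z₀ hμ (rY z₀ g) hG0 (fun y hy => by rw [hrY, if_neg hy])
        (fun y => by
          rw [hrY]
          by_cases hy : id y = z₀
          · rw [if_pos hy]; exact hgG y
          · rw [if_neg hy, norm_zero]; exact hG0)
    have e := norm_adjoint_QtildeTower_apply_le L m n φ (c₀ := c₀) U hRlev (rY z₀ g) x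
    rw [hQacl, LinearMap.coe_toContinuousLinearMap', hQt]
    refine e.trans ?_
    calc Real.sqrt c₁ * (((L : ℝ) ^ (n + 1)) ^ d)⁻¹ / c₀ * ‖rY z₀ g‖
        ≤ Real.sqrt c₁ * (((L : ℝ) ^ (n + 1)) ^ d)⁻¹ / c₀ * (Real.sqrt c₁ * Gs) := by gcongr
      _ = c₁ / (c₀ * ((L : ℝ) ^ (n + 1)) ^ d) * Gs := by
          rw [show Real.sqrt c₁ * (((L : ℝ) ^ (n + 1)) ^ d)⁻¹ / c₀ * (Real.sqrt c₁ * Gs) =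
            Real.sqrt c₁ * Real.sqrt c₁ * ((((L : ℝ) ^ (n + 1)) ^ d)⁻¹ / c₀) * Gs by ring, Real.mul_self_sqrt hc₁.le]
          field_simp
      _ = 1 * Gs := by rw [← hw, div_self (ne_of_gt (by positivity)), one_mul]
  -- the block-supported, sup-bounded form of `Q̃′_k† g` for `g` supported at ONE coarse site (used by the duality step)
  have hQa_supp : ∀ (v : TSite d m) (g : SiteL2K ℂ d m c₁ W), (∀ u, id u ≠ v → WL2.equiv ℂ (fun _ : TSite d m => c₁) W g u = 0) →
      ∀ x, blockCoord (L ^ (n + 1)) m (siteCast (towerP_eq_fineP_pow L m (n + 1)) x) ≠ v →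
        WL2.equiv ℂ (fun _ : TSite d (towerP L m (n + 1)) => c₀) W (Qacl g) x = 0 := by
    intro v g hgv x hx
    have e := adjoint_QtildeTower_apply_eq_of_eq_at L m n φ (c₀ := c₀) U g 0 x (fun z hz => by
      have hz' : blockCoord (L ^ (n + 1)) m (siteCast (towerP_eq_fineP_pow L m (n + 1)) x) = z := (bigBlock_eq_iff L m n x z).2 hz
      have hzv : z ≠ v := fun hzv => hx (hz'.trans hzv)
      rw [hgv z hzv, WL2.equiv_zero, Pi.zero_apply])
    rw [hQacl, LinearMap.coe_toContinuousLinearMap', hQt, e, map_zero, WL2.equiv_zero, Pi.zero_apply]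
  have hQaρ : ∀ (v : TSite d m) (g : SiteL2K ℂ d m c₁ W), (∀ u, id u ≠ v → WL2.equiv ℂ (fun _ : TSite d m => c₁) W g u = 0) →
      ∀ x, (0 : ℝ) < tdist m (blockCoord (L ^ (n + 1)) m (siteCast (towerP_eq_fineP_pow L m (n + 1)) x)) v →
        WL2.equiv ℂ (fun _ : TSite d (towerP L m (n + 1)) => c₀) W (Qacl g) x = 0 :=
    fun v g hgv x hx => hQa_supp v g hgv x (fun hxv => by rw [hxv, tdist_self] at hx; exact lt_irrefl _ hx)
  have hQa := letter_of_range (tdist m) (id : TSite d m → TSite d m)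
    (fun x : TSite d (towerP L m (n + 1)) => blockCoord (L ^ (n + 1)) m (siteCast (towerP_eq_fineP_pow L m (n + 1)) x)) Qacl (M := 1) (ρ := 0) (κ := κ) hκ0.le hQaM hQaρ
  -- (L)(D_UG′_k) from (GRC), output at the bond's TIP block, weakened to `κ` ((K70) verbatim)
  have hDG : ∀ (v : TSite d m) (f : SiteL2K ℂ d (towerP L m (n + 1)) c₀ W) (F : ℝ),
      (∀ x, blockCoord (L ^ (n + 1)) m (siteCast (towerP_eq_fineP_pow L m (n + 1)) x) ≠ v →
        WL2.equiv ℂ (fun _ : TSite d (towerP L m (n + 1)) => c₀) W f x = 0) →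
      (∀ x, ‖WL2.equiv ℂ (fun _ : TSite d (towerP L m (n + 1)) => c₀) W f x‖ ≤ F) →
      ∀ x, ‖WL2.equiv ℂ (fun _ : Bond d (towerP L m (n + 1)) => c₀) W (DGcl f) x‖ ≤
        BD * Real.exp (-(κ * tdist m (blockCoord (L ^ (n + 1)) m (siteCast (towerP_eq_fineP_pow L m (n + 1)) (btgt x))) v)) * F := by
    intro v f F hfv hfF x
    have hF : 0 ≤ F := (norm_nonneg _).trans (hfF b.1)
    have h := HD n η hηL c₀ c₁ hw m U hRS α hα hαD_ hUb hUη hUgrad εU hεU hεg hUε hLb hUst hRlev hpos' PS hPS v f F hF hfv hfF x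
    rw [hDGcl, LinearMap.coe_toContinuousLinearMap', LinearMap.comp_apply, hDl, hGP]
    calc _ ≤ BD * F * Real.exp (-(κD * tdist m (blockCoord (L ^ (n + 1)) m (siteCast (towerP_eq_fineP_pow L m (n + 1)) (btgt x))) v)) := h
      _ ≤ BD * F * Real.exp (-(κ * tdist m (blockCoord (L ^ (n + 1)) m (siteCast (towerP_eq_fineP_pow L m (n + 1)) (btgt x))) v)) :=
          mul_le_mul_of_nonneg_left (exp_weaken' hκD' (tdist_nonneg m _ _)) (mul_nonneg hBD hF)
      _ = _ := by ring
  -- (L)(c_k) from (K64a), weakened to `κ` ((K70) verbatim)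
  have hCk : ∀ (v : TSite d m) (g : SiteL2K ℂ d m c₁ W) (F : ℝ), (∀ u, id u ≠ v → WL2.equiv ℂ (fun _ : TSite d m => c₁) W g u = 0) →
      (∀ u, ‖WL2.equiv ℂ (fun _ : TSite d m => c₁) W g u‖ ≤ F) →
      ∀ u, ‖WL2.equiv ℂ (fun _ : TSite d m => c₁) W (Ccl g) u‖ ≤ BC * Real.exp (-(κ * tdist m (id u) v)) * F := by
    intro v g F hgv hgF u
    have hF : 0 ≤ F := (norm_nonneg _).trans (hgF v)
    have h := HC n η hηL c₀ c₁ hw hρ m hm U αU hα1 hU1 hreg εU hεU hUε hLb α hα hαC_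
      hUst hUb hUη hpl hεg hpos' rY hrY v g F (fun y hy => hgv y hy) hgF u
    rw [hCcl, LinearMap.coe_toContinuousLinearMap', hc]
    exact h.trans (mul_le_mul_of_nonneg_right (mul_le_mul_of_nonneg_left (exp_weaken' hκC' (tdist_nonneg m _ _)) hBC) hF)
  -- THE DUALITY STEP: (L)(T1; (c₀∕c₁)·B_D, κ) — the coarse field `Q̃′_k(G′_k(D_U†(χ_b z)))` is `(L^{n+1})^{−d}`-small and decays from the source block `vb`
  have hEb_apply : ∀ (w : W) (x : Bond d (towerP L m (n + 1))),
      WL2.equiv ℂ (fun _ : Bond d (towerP L m (n + 1)) => c₀) W (Eb w) x = (Pi.single b w : Bond d (towerP L m (n + 1)) → W) x := fun w x => by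
    rw [hEb, LinearMap.comp_apply, LinearEquiv.coe_toLinearMap, WL2.linearEquiv_symm_apply, Equiv.apply_symm_apply, LinearMap.single_apply]
  have hEv_apply : ∀ (h : SiteL2K ℂ d m c₁ W), Ev h = WL2.equiv ℂ (fun _ : TSite d m => c₁) W h vb := fun h => by
    rw [hEv, LinearMap.comp_apply, LinearEquiv.coe_toLinearMap, WL2.linearEquiv_apply, LinearMap.proj_apply]
  have hdual : ∀ (w : W) (y : TSite d m),
      ‖WL2.equiv ℂ (fun _ : TSite d m => c₁) W (Qt (GP (LinearMap.adjoint Dl (Eb w)))) y‖ ≤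
        (c₀ / c₁ * BD) * Real.exp (-(κ * tdist m (id y) vb)) * ‖w‖ := by
    intro w y
    obtain ⟨uu, huu⟩ : ∃ uu : SiteL2K ℂ d m c₁ W, uu = Qt (GP (LinearMap.adjoint Dl (Eb w))) := ⟨_, rfl⟩
    obtain ⟨uy, huy⟩ : ∃ uy : W, uy = WL2.equiv ℂ (fun _ : TSite d m => c₁) W uu y := ⟨_, rfl⟩
    obtain ⟨g₀, hg₀⟩ : ∃ g₀ : SiteL2K ℂ d m c₁ W, g₀ = (WL2.linearEquiv ℂ ℂ (fun _ : TSite d m => c₁)).symm (Pi.single y uy) := ⟨_, rfl⟩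
    rw [← huu, ← huy]
    have h1 : ⟪g₀, uu⟫_ℂ = (c₁ : ℂ) * ⟪uy, uy⟫_ℂ := by
      rw [hg₀, inner_single_left, ← huy]
    have hGPadj : LinearMap.adjoint GP = GP := by rw [hGP]; exact adjoint_GpOfUk L m n φ c₀ η U c₁ a' hRS hpos'
    have h2 : ⟪g₀, uu⟫_ℂ = (c₀ : ℂ) * ⟪WL2.equiv ℂ (fun _ : Bond d (towerP L m (n + 1)) => c₀) W (Dl (GP (LinearMap.adjoint Qt g₀))) b, w⟫_ℂ := by
      rw [huu, ← LinearMap.adjoint_inner_left Qt, ← LinearMap.adjoint_inner_left GP, hGPadj, LinearMap.adjoint_inner_right, WL2.inner_def,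
        Finset.sum_eq_single b]
      · rw [hEb_apply, Pi.single_eq_same]
        try rfl
      · intro x _ hx
        rw [hEb_apply, Pi.single_eq_of_ne hx, inner_zero_right, mul_zero]
      · intro h; exact absurd (Finset.mem_univ b) h
    have hg₀v : ∀ u, id u ≠ y → WL2.equiv ℂ (fun _ : TSite d m => c₁) W g₀ u = 0 := fun u hu => by
      rw [hg₀, WL2.linearEquiv_symm_apply, Equiv.apply_symm_apply, Pi.single_eq_of_ne (show u ≠ y from hu)]
    have hg₀F : ∀ u, ‖WL2.equiv ℂ (fun _ : TSite d m => c₁) W g₀ u‖ ≤ ‖uy‖ := by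
      intro u
      rw [hg₀, WL2.linearEquiv_symm_apply, Equiv.apply_symm_apply]
      by_cases hu : u = y
      · rw [hu, Pi.single_eq_same]
      · rw [Pi.single_eq_of_ne hu, norm_zero]; exact norm_nonneg _
    have h3 : ‖WL2.equiv ℂ (fun _ : Bond d (towerP L m (n + 1)) => c₀) W (Dl (GP (LinearMap.adjoint Qt g₀))) b‖ ≤
        BD * Real.exp (-(κ * tdist m vb y)) * (1 * ‖uy‖) := by
      have hsupp : ∀ x, blockCoord (L ^ (n + 1)) m (siteCast (towerP_eq_fineP_pow L m (n + 1)) x) ≠ y →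
          WL2.equiv ℂ (fun _ : TSite d (towerP L m (n + 1)) => c₀) W (Qacl g₀) x = 0 := hQa_supp y g₀ hg₀v
      have hsup : ∀ x, ‖WL2.equiv ℂ (fun _ : TSite d (towerP L m (n + 1)) => c₀) W (Qacl g₀) x‖ ≤ 1 * ‖uy‖ := hQaM g₀ ‖uy‖ hg₀F
      have h := hDG y (Qacl g₀) (1 * ‖uy‖) hsupp hsup b
      rw [hQacl, LinearMap.coe_toContinuousLinearMap', hDGcl, LinearMap.coe_toContinuousLinearMap', LinearMap.comp_apply, ← hvb] at h
      exact h
    have h4 : c₁ * ‖uy‖ ^ 2 ≤ c₀ * (BD * Real.exp (-(κ * tdist m vb y)) * ‖uy‖) * ‖w‖ := by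
      have h1' : ⟪g₀, uu⟫_ℂ = ((c₁ * ‖uy‖ ^ 2 : ℝ) : ℂ) := by
        rw [h1, inner_self_eq_norm_sq_to_K]
        try simp only [RCLike.ofReal_eq_complex_ofReal]
        push_cast; ring
      have hn : ‖⟪g₀, uu⟫_ℂ‖ = c₁ * ‖uy‖ ^ 2 := by
        rw [h1', Complex.norm_real, Real.norm_of_nonneg (by positivity)]
      rw [← hn, h2, norm_mul, Complex.norm_real, Real.norm_of_nonneg hc₀.le, mul_assoc]
      refine mul_le_mul_of_nonneg_left ?_ hc₀.le
      refine (norm_inner_le_norm _ _).trans ?_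
      exact mul_le_mul_of_nonneg_right (h3.trans (le_of_eq (by ring))) (norm_nonneg w)
    have hgoal : ‖uy‖ ≤ (c₀ / c₁ * BD) * Real.exp (-(κ * tdist m (id y) vb)) * ‖w‖ := by
      rw [show (id y : TSite d m) = y from rfl, tdist_symm hm]
      rcases (norm_nonneg uy).eq_or_lt with hu0 | hupos
      · rw [← hu0]; positivity
      · have h6 : (c₁ * ‖uy‖) * ‖uy‖ ≤ (c₀ * (BD * Real.exp (-(κ * tdist m vb y))) * ‖w‖) * ‖uy‖ :=
          calc (c₁ * ‖uy‖) * ‖uy‖ = c₁ * ‖uy‖ ^ 2 := by ring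
            _ ≤ _ := h4
            _ = _ := by ring
        calc ‖uy‖ = (c₁ * ‖uy‖) / c₁ := by field_simp
          _ ≤ (c₀ * (BD * Real.exp (-(κ * tdist m vb y))) * ‖w‖) / c₁ := div_le_div_of_nonneg_right (le_of_mul_le_mul_right h6 hupos) hc₁.le
          _ = (c₀ / c₁ * BD) * Real.exp (-(κ * tdist m vb y)) * ‖w‖ := by field_simp
    exact hgoal
  have hT1L : ∀ (v : TSite d m) (h : SiteL2K ℂ d m c₁ W) (F : ℝ), (∀ u, id u ≠ v → WL2.equiv ℂ (fun _ : TSite d m => c₁) W h u = 0) →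
      (∀ u, ‖WL2.equiv ℂ (fun _ : TSite d m => c₁) W h u‖ ≤ F) →
      ∀ y, ‖WL2.equiv ℂ (fun _ : TSite d m => c₁) W (T1 h) y‖ ≤ (c₀ / c₁ * BD) * Real.exp (-(κ * tdist m (id y) v)) * F := by
    intro v h F hhv hhF y
    have hF : 0 ≤ F := (norm_nonneg _).trans (hhF v)
    have eT : T1 h = Qt (GP (LinearMap.adjoint Dl (Eb (WL2.equiv ℂ (fun _ : TSite d m => c₁) W h vb)))) := by
      rw [hT1, LinearMap.coe_toContinuousLinearMap']
      simp only [LinearMap.comp_apply, hEv_apply]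
    rw [eT]
    by_cases hv : vb = v
    · -- the source block: duality bound with `‖h vb‖ ≤ F`
      subst hv
      exact (hdual _ y).trans (mul_le_mul_of_nonneg_left (hhF vb) (by positivity))
    · -- otherwise `h vb = 0` and everything vanishes
      have h0 : WL2.equiv ℂ (fun _ : TSite d m => c₁) W h vb = 0 := hhv vb (by rw [show (id vb : TSite d m) = vb from rfl]; exact hv)
      rw [h0, map_zero, map_zero, map_zero, map_zero, WL2.equiv_zero, Pi.zero_apply, norm_zero]
      positivity
  -- the three compositions on the coarse torus (rate lost once)
  have hgap : 0 < κ - κ / 2 := sub_pos.2 (half_lt_self hκ0)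
  have hκh0 : (0 : ℝ) ≤ κ / 2 := (half_pos hκ0).le
  have hκh : κ / 2 ≤ κ := half_le_self hκ0.le
  have he0 : (0 : ℝ) ≤ 1 * Real.exp (κ * 0) := mul_nonneg zero_le_one (Real.exp_nonneg _)
  have hB0 : (0 : ℝ) ≤ c₀ / c₁ * BD := by positivity
  have hB1 : (0 : ℝ) ≤ c₀ / c₁ * BD * BC * K := by positivity
  have hB2 : (0 : ℝ) ≤ c₀ / c₁ * BD * BC * K * (1 * Real.exp (κ * 0)) * K := by positivity
  have hS : ∀ w' : TSite d m, ∑ u : TSite d m, Real.exp (-((κ - κ / 2) * tdist m w' u)) ≤ K := fun w' => by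
    rw [hKdef]; exact torusSum_le d hm hgap w'
  have h₁ := letter_comp (tdist m) (id : TSite d m → TSite d m) (id : TSite d m → TSite d m) (id : TSite d m → TSite d m)
    T1 Ccl (tdist_nonneg m) (fun u y w' => tdist_triangle hm u y w')
    (B₁ := c₀ / c₁ * BD) (B₂ := BC) (κ₁ := κ) (κ₂ := κ) (κ' := κ / 2) (S := K) hB0 hBC hκh0 hκh hT1L hCk hS
  have h₂ := letter_comp (tdist m) (id : TSite d m → TSite d m) (id : TSite d m → TSite d m)
    (fun x : TSite d (towerP L m (n + 1)) => blockCoord (L ^ (n + 1)) m (siteCast (towerP_eq_fineP_pow L m (n + 1)) x))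
    (Ccl ∘L T1) Qacl (tdist_nonneg m) (fun u y w' => tdist_triangle hm u y w')
    (B₁ := c₀ / c₁ * BD * BC * K) (B₂ := 1 * Real.exp (κ * 0)) (κ₁ := κ / 2) (κ₂ := κ) (κ' := κ / 2) (S := K) hB1 he0 hκh0 le_rfl h₁ hQa hS
  have h₃ := letter_comp (tdist m) (id : TSite d m → TSite d m)
    (fun x : TSite d (towerP L m (n + 1)) => blockCoord (L ^ (n + 1)) m (siteCast (towerP_eq_fineP_pow L m (n + 1)) x))
    (fun x : Bond d (towerP L m (n + 1)) => blockCoord (L ^ (n + 1)) m (siteCast (towerP_eq_fineP_pow L m (n + 1)) (btgt x)))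
    (Qacl ∘L (Ccl ∘L T1)) DGcl (tdist_nonneg m) (fun u y w' => tdist_triangle hm u y w')
    (B₁ := c₀ / c₁ * BD * BC * K * (1 * Real.exp (κ * 0)) * K) (B₂ := BD) (κ₁ := κ / 2) (κ₂ := κ) (κ' := κ / 2) (S := K) hB2 hBD hκh0 le_rfl h₂ hDG hS
  -- the source `h₀ := δ_{vb}⊗z` (supported at `vb`, sup `‖z‖`)
  obtain ⟨h₀, hh₀⟩ : ∃ h₀ : SiteL2K ℂ d m c₁ W, h₀ = (WL2.linearEquiv ℂ ℂ (fun _ : TSite d m => c₁)).symm (Pi.single vb z) := ⟨_, rfl⟩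
  have hh₀v : ∀ u, id u ≠ vb → WL2.equiv ℂ (fun _ : TSite d m => c₁) W h₀ u = 0 := fun u hu => by
    rw [hh₀, WL2.linearEquiv_symm_apply, Equiv.apply_symm_apply, Pi.single_eq_of_ne (show u ≠ vb from hu)]
  have hh₀F : ∀ u, ‖WL2.equiv ℂ (fun _ : TSite d m => c₁) W h₀ u‖ ≤ ‖z‖ := by
    intro u
    rw [hh₀, WL2.linearEquiv_symm_apply, Equiv.apply_symm_apply]
    by_cases hu : u = vb
    · rw [hu, Pi.single_eq_same]
    · rw [Pi.single_eq_of_ne hu, norm_zero]; exact norm_nonneg _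
  have hword := h₃ vb h₀ ‖z‖ hh₀v hh₀F b'
  -- the (3.25) identity: `D_U((1 − R_k)(D_U†χ)) = (D_UG′_k)(Q̃′_k†(c(Q̃′_k(G′_k(D_U†χ))))) = DGcl (Qacl (Ccl (T1 h₀)))`
  have eEv : WL2.equiv ℂ (fun _ : TSite d m => c₁) W h₀ vb = z := by
    rw [hh₀, WL2.linearEquiv_symm_apply, Equiv.apply_symm_apply, Pi.single_eq_same]
  have eEb : Eb z = (WL2.linearEquiv ℂ ℂ (fun _ : Bond d (towerP L m (n + 1)) => c₀)).symm (Pi.single b z) := by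
    rw [hEb, LinearMap.comp_apply, LinearEquiv.coe_toLinearMap, LinearMap.single_apply]
  have eR := RofUk_eq_formula L m n φ c₀ η U c₁ a' hRS hpos'
    (LinearMap.adjoint (covDerivL2K ℂ c₀ ((η : ℂ))⁻¹ (adTransportW φ U))
      ((WL2.linearEquiv ℂ ℂ (fun _ : Bond d (towerP L m (n + 1)) => c₀)).symm (Pi.single b z)))
  have e1 : covDerivL2K ℂ c₀ ((η : ℂ))⁻¹ (adTransportW φ U)
      (LinearMap.adjoint (covDerivL2K ℂ c₀ ((η : ℂ))⁻¹ (adTransportW φ U))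
          ((WL2.linearEquiv ℂ ℂ (fun _ : Bond d (towerP L m (n + 1)) => c₀)).symm (Pi.single b z)) -
        RofUk L m n φ η U (c₀ := c₀)
          (LinearMap.adjoint (covDerivL2K ℂ c₀ ((η : ℂ))⁻¹ (adTransportW φ U))
            ((WL2.linearEquiv ℂ ℂ (fun _ : Bond d (towerP L m (n + 1)) => c₀)).symm (Pi.single b z)))) =
      (DGcl ∘L (Qacl ∘L (Ccl ∘L T1))) h₀ := by
    rw [eR, sub_sub_cancel]
    simp only [hDGcl, hQacl, hCcl, hT1, hc, hQt, hGP, hDl, ContinuousLinearMap.comp_apply, LinearMap.coe_toContinuousLinearMap', LinearMap.comp_apply,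
      hEv_apply, eEv, eEb]
  rw [e1, ← hvb]
  refine hword.trans (le_of_eq ?_)
  rw [hBs, hratio]
  ring

end Summit.QuantumFields.YangMills.Theorems.Prop7TowerDPDstarPointRow

end
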